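import Mathlib
import Summits.QuantumFields.Balaban3D.Carriers.Tower
import Summits.QuantumFields.Balaban3D.Proofs.LargeFieldKnit
import Summits.QuantumFields.Balaban3D.Proofs.HistCount
import Summits.QuantumFields.Balaban3D.Proofs.Run3Collar
import Summits.QuantumFields.Balaban3D.Proofs.LargeFieldKnitAdm

/-!
# `Summit.QuantumFields.Balaban3D.Proofs.Run3LargeField` — lane «pub-balaban3d» (Bałaban, CMP **102** (1985) 255–275, d = 3
# lattice UV stability AS PRINTED), prover seat p2: the large-field leaf `B10Assembly.LeafSystem.lf` INSTANTIATED at the lane's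
# constructed tower `Carriers.TowerInput.tower3` (seat p1) — the history model, the collar-cover and Z-term leaves, and the leaf
# itself modulo the small factors (67)–(71), the collar count and the printed/not-printed provisos

HONEST FRAMING (lane PLAN.md §0).  [B10] = [Balaban1985UV3]: UV stability of the d = 3 Wilson lattice gauge theory on a finite torus;
NOT a continuum limit, NOT d = 4, NOT the Clay problem.  Nothing of the paper is asserted.  This file PLUGS the lane's concrete
carriers into the 4D cell's large-field resummation (`B10LargeFieldSum.largeFieldControl_of_resummation`, explicit form
`…Proofs.LargeFieldKnit.largeFieldControl_explicit`): the tower `D.tower3` of `Carriers.Tower` (histories = scale-tagged large-field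
plaquette sets `Carriers.Hist S.P k`, lead rulings R-HIST′/D-41; the functional `LF` of (41) = `Carriers.LF D.W`; `Zterm := Σ_{j<k}
zcoef_j·|Z_j|` of the spine `…Balaban1985CMP102.SectB.TowerObjects`).
* `histModel3` — the `B10LargeFieldSum.HistModel` of `D.tower3.toTowerRun`: candidates `E k = allCodes S.P k` (all scale-tagged
  plaquette codes, `k ≤ K`), `disc k h = Hist.disc h` (p1; injective), `σ = 3 log L`, `card_E` = the plaquette count
  `…Proofs.HistCount.card_filter_allCodes_le_exp` (3 orientations × `L^{3(k−j)}` sites), `A₀ = 0` and `dominated` = p1's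
  `Carriers.lf_dominated` (masses ≤ 1, a history IS its large-field set), `zvol k j Q` := THE COLLAR BOUND ITSELF
  `Σ_{(i,p′)∈Q, i≤j} (c_g ρ x(g_i)^{r₀})³` — so that `ZvolCover` holds by reflexivity (`zvolCover3`) and the geometric content
  «|Z_j(h)| ≤ collar bound» sits in ONE named hypothesis `hcollar` of `ztermRate3` (the count of `L^jη`-lattice points in the
  accumulated collars of (39)/p. 268; lattice half = `…Proofs.TorusBalls.card_torusBall_le`, set half = p1's regions `Carriers.Omega`
  — to be discharged when p1's cover lemma lands);
* `ztermRate3` — the leaf `ZtermRate` for the tower from the spine's BOOKED Z-terms (lead A8/R-CONST: `0 ≤ zcoef_j ≤ A·x(g_j)`) and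
  `hcollar` (`…Proofs.LargeFieldKnit.ztermRate_of_booked`);
* `lf_tower3` — **the field `LeafSystem.lf` for `D.tower3.toTowerRun`**, literally, for any `Consts C` with `C.d = 6/log C.L`, from:
  the small-factors leaf `SmallFactorsAll (histModel3 …) c₁ gs` ((67)–(71) — hypothesis here; its discharge from the local per-plaquette
  theorem `…Proofs.PerPlaquette71.perPlaquette71_local` needs p1's lift of `U_k` to `ηℤ³`, LEAF-LEDGER A5/A6), the Z-term data,
  `hcollar`, and the provisos of the 4D cell NOT IN PRINT (`3r₀ + 2 ≤ 2p₀`, the `b₀`-thresholds; GAPS G-B10-02, G-B10-10(d)).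
-/

noncomputable section

namespace Summit.QuantumFields.Balaban3D.Proofs.Run3LargeField

open Literature.MathematicalPhysics.QuantumFieldTheory.Balaban1983to89
open Literature.MathematicalPhysics.QuantumFieldTheory.Balaban1985CMP102
open Literature.MathematicalPhysics.QuantumFieldTheory.Balaban1985CMP102.Setting
open Summit.QuantumFields.Balaban3D.Carriers
open Summit.QuantumFields.Balaban3D.Proofs.LargeFieldKnit (ztermRate_of_booked lf_leaf_of_leaves)
open Summit.QuantumFields.Balaban3D.Proofs.HistCount (card_filter_allCodes_le_exp)
open B10LargeField (xlog one_le_xlog)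
open Summit.QuantumFields.Balaban3D.Proofs.Run3Collar (zvol_le_sum)
open Summit.QuantumFields.Balaban3D.Proofs.LargeFieldKnitAdm (lf_leaf_of_leaves_adm)
open B10LargeFieldSum
open Finset

variable {L : ℕ} {S : Scales L} {G : Type} [GaugeGroup G] [MeasurableSpace G] [HaarData G]

/-! ## §1 The history model of the constructed tower -/

/-- **The history model of `D.tower3`** (the refined carrier of the 4D cell's large-field resummation,
`B10LargeFieldSum.HistModel`, p. 266 (41) / p. 273 «all plaquettes in all large fields set P»), built from seat p1's finite histories:
candidates = all scale-tagged plaquette codes of scales `< k` (for `k ≤ K`; empty beyond the run), the discrete data of a history =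
its own large-field set (`Hist.disc`, injective), `σ = 3 log L`, NO mass inflation (`A₀ = 0`: masses `≤ 1`, `Carriers.lf_dominated`), and
`zvol` := the collar bound of (39)/p. 268 as a function of the discrete data (constants `c_g, ρ = R₁M₁, r₀`).  Hypothesis `hsites`:
«|T₁^{(k)}| = the number of sites of `T^{(k)}`» for `k ≤ K` (p. 256 L39; seat p3's `sites_eq_card`). [cite: Balaban1985UV3, (41) p.266] -/
def histModel3 (D : TowerInput S G) (cg ρ r₀ : ℝ)
    (hsites : ∀ k, k ≤ S.K → S.sites k = (Fintype.card (Site S.P k) : ℝ)) :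
    HistModel D.tower3.toTowerRun where
  α := PlaqCode S.P
  E k := if k ≤ S.K then allCodes S.P k else ∅
  E_lt k e he := by
    by_cases hk : k ≤ S.K
    · rw [if_pos hk] at he
      exact Hist.disc_lt _ e he
    · rw [if_neg hk] at he
      exact absurd he (Finset.notMem_empty e)
  σ := 3 * Real.log L
  card_E k j hjk := by
    by_cases hk : k ≤ S.K
    · rw [if_pos hk]
      have hk' : k ≤ S.P.m + S.P.K := by
        show k ≤ S.m + S.K
        omega
      have h := card_filter_allCodes_le_exp (P := S.P) rfl hjk hk'
      have hs : D.tower3.toTowerRun.sites k = (Fintype.card (Site S.P k) : ℝ) := hsites k hk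
      rw [hs]
      exact h
    · rw [if_neg hk, Finset.filter_empty, Finset.card_empty, Nat.cast_zero]
      have := D.tower3.toTowerRun.sites_nonneg k
      positivity
  disc k h := if k ≤ S.K then Hist.disc (P := S.P) h else ∅
  disc_sub k h := by
    by_cases hk : k ≤ S.K
    · rw [if_pos hk, if_pos hk]
      exact Hist.disc_subset_allCodes _
    · rw [if_neg hk, if_neg hk]
  zvol k j Q := ∑ e ∈ Q.filter (fun e => e.1 ≤ j), (cg * ρ) ^ 3 * xlog (D.tower3.toTowerRun.g e.1) ^ (3 * r₀)
  A₀ := 0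
  A₀_nonneg := le_rfl
  dominated k hk U F B hFB := by
    have hk' : k ≤ S.K := hk
    have h1 : ∀ h : Hist S.P k, F h ≤ B h.disc := fun h => by
      have := hFB h
      rwa [if_pos hk'] at this
    have h2 := lf_dominated D.W k U F B h1
    simp only [zero_mul, add_zero, if_pos hk']
    exact h2

/-! ## §2 The collar-cover and Z-term leaves -/

/-- `ZvolCover` for the tower holds by construction of `zvol` (the collar bound is the definition). [cite: Balaban1985UV3, (39) p.266] -/
theorem zvolCover3 (D : TowerInput S G) (cg ρ r₀ : ℝ)
    (hsites : ∀ k, k ≤ S.K → S.sites k = (Fintype.card (Site S.P k) : ℝ)) :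
    ZvolCover (histModel3 D cg ρ r₀ hsites) cg ρ r₀ :=
  fun _ _ _ _ _ _ => le_rfl

/-- **The leaf `ZtermRate` for the tower** (p. 266 (41) «+ Σ_{j=0}^{k−1} O(log g_j⁻¹)|Z_j|»): from the spine's booked Z-terms
`Zterm k h = Σ_{j<k} zcoef_j·|Z_j|(h)` (`SectB.TowerObjects.Zterm`, `|Z_j|(h)` = p1's count `Carriers.ZVol`) with `0 ≤ zcoef_j ≤
A·x(g_j)` (lead R-CONST / LEAF-LEDGER A8), and the COLLAR COUNT `hcollar`: «|Z_j|(h) ≤ Σ_{(i,p′) ∈ P(h), i ≤ j} (c_g ρ x(g_i)^{r₀})³» for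
`j < k ≤ K` ((39) p. 266, p. 268 rule; set half = p1's `Carriers.Omega`, lattice half = `…Proofs.TorusBalls`) — a hypothesis here.
[cite: Balaban1985UV3, (41) p.266, (39) p.266] -/
theorem ztermRate3 (D : TowerInput S G) (cg ρ r₀ A : ℝ)
    (hsites : ∀ k, k ≤ S.K → S.sites k = (Fintype.card (Site S.P k) : ℝ))
    (hcollar : ∀ k, k ≤ S.K → ∀ (h : Hist S.P k) (j : ℕ), j < k →
      (ZVol D.M₁ D.Rcol k h j : ℝ) ≤
        ∑ e ∈ (Hist.disc h).filter (fun e => e.1 ≤ j), (cg * ρ) ^ 3 * xlog (S.gk e.1) ^ (3 * r₀))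
    (hz0 : ∀ j, j < S.K → 0 ≤ D.zcoef j) (hz : ∀ j, j < S.K → D.zcoef j ≤ A * xlog (S.gk j)) :
    ZtermRate (histModel3 D cg ρ r₀ hsites) A := by
  refine ztermRate_of_booked (histModel3 D cg ρ r₀ hsites) D.zcoef (fun k h j => (ZVol D.M₁ D.Rcol k h j : ℝ))
    (fun k h => rfl) ?_ (fun k h j => Nat.cast_nonneg _) hz0 hz
  intro k hk h j hjk
  have hk' : k ≤ S.K := hk
  show (ZVol D.M₁ D.Rcol k h j : ℝ) ≤
    ∑ e ∈ (if k ≤ S.K then Hist.disc (P := S.P) h else ∅).filter (fun e => e.1 ≤ j),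
      (cg * ρ) ^ 3 * xlog (S.gk e.1) ^ (3 * r₀)
  rw [if_pos hk']
  exact hcollar k hk' h j hjk

/-! ## §3 The leaf `LeafSystem.lf` for the constructed tower -/

/-- **`B10Assembly.LeafSystem.lf` FOR THE LANE'S TOWER `D.tower3`** (pp. 273–274: «The analysis of Sect. 3.C [9], which is model
independent, show that these small factors are enough to control all sums in (41) …»), literally the field type, for any family of
constants `C` with `C.d = 6/log C.L`, `C.L = L` and the tower's couplings on the flow `g_j = gRun C.g C.L ε j` (seat p3's normalised units:
`C.g = 1`, `ε = g²ε`).  FROM: the small-factors leaf ((67)–(71), hypothesis `hSF` — its discharge via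
`…Proofs.PerPlaquette71.perPlaquette71_local` waits for p1's lift of `U_k`), the booked Z-term rates, the collar count `hcollar`, and the
provisos `3r₀ + 2 ≤ 2p₀`, `8·A·(c_gρ)³/(½log L) ≤ c₁b₀²`, `c₁b₀² ≥ 56` (NOT IN PRINT: 4D cell GAPS G-B10-02, G-B10-10(d)).
[cite: Balaban1985UV3, pp.273–274] -/
theorem lf_tower3 (C : B10Assembly.Consts) (hd : C.d = 6 / Real.log C.L) (hCL : C.L = (L : ℝ)) (D : TowerInput S G)
    {cg ρ r₀ A c₁ gs ε : ℝ}
    (hsites : ∀ k, k ≤ S.K → S.sites k = (Fintype.card (Site S.P k) : ℝ))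
    (hSF : SmallFactorsAll (histModel3 D cg ρ r₀ hsites) c₁ gs)
    (hcollar : ∀ k, k ≤ S.K → ∀ (h : Hist S.P k) (j : ℕ), j < k →
      (ZVol D.M₁ D.Rcol k h j : ℝ) ≤
        ∑ e ∈ (Hist.disc h).filter (fun e => e.1 ≤ j), (cg * ρ) ^ 3 * xlog (S.gk e.1) ^ (3 * r₀))
    (hz0 : ∀ j, j < S.K → 0 ≤ D.zcoef j) (hz : ∀ j, j < S.K → D.zcoef j ≤ A * xlog (S.gk j))
    (hA : 0 ≤ A) (hcg : 0 ≤ cg * ρ) (hr : 0 ≤ r₀) (hε : 0 < ε)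
    (hrun : ∀ j, S.gk j = B10.gRun C.g C.L ε j)
    (hg : ∀ j, j ≤ S.K → 0 < S.gk j ∧ S.gk j ≤ gs) (hgs : gs ≤ 1)
    (hp : r₀ * 3 + 2 ≤ 2 * D.p₀)
    (hb₁ : 8 * (A * (cg * ρ) ^ 3 / (Real.log C.L / 2)) ≤ c₁ * D.b₀ ^ 2)
    (hb₂ : 56 ≤ c₁ * D.b₀ ^ 2) :
    ∀ k, k ≤ D.tower3.toTowerRun.K → ∀ U : D.tower3.toTowerRun.Cfg k,
      D.tower3.toTowerRun.LF k U (fun h => -(D.tower3.toTowerRun.mainT k h U) + D.tower3.toTowerRun.Zterm k h) ≤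
        Real.exp (C.d * D.tower3.toTowerRun.sites k) := by
  have hA₀ : (histModel3 D cg ρ r₀ hsites).A₀ = 0 := rfl
  refine lf_leaf_of_leaves C hd (histModel3 D cg ρ r₀ hsites) hSF (ztermRate3 D cg ρ r₀ A hsites hcollar hz0 hz)
    (zvolCover3 D cg ρ r₀ hsites) hA hcg hr hε hrun hg hgs ?_ hp ?_ hb₂
  · show 3 * Real.log (L : ℝ) = 3 * Real.log C.L
    rw [hCL]
  · rw [hA₀, add_zero]
    exact hb₁

/-! ## §4 The collar count discharged (p2 `Run3Collar.zvol_le_sum`) and the leaf without `hcollar` -/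

/-- **THE COLLAR COUNT FOR THE TOWER, REAL FORM** — the hypothesis `hcollar` of `ztermRate3`/`lf_tower3` DISCHARGED from
`…Proofs.Run3Collar.zvol_le_sum` (collar chain + torus ball count over p1's regions): for big-block size `M₁ ≥ 1`, collar widths
`Rcol` antitone with `Rcol i ≤ ρ′·x(g_i)^{r₀}` ON THE WINDOW `i ≤ K` (`Rcol i = ⌈R(g_i)⌉M₁`, `R(g) = R₁x(g)^{r₀}`, so `ρ′ = (R₁+1)M₁`),
`L ≥ 2`, `0 < g_i ≤ 1` for `i ≤ K`:
«|Z_j(h)| ≤ Σ_{(i,p′) ∈ P(h), i ≤ j} (K_c·x(g_i)^{r₀})³», `K_c = 2(2ρ′ + 2B + 20)`, `B = 3L(M₁ − 1) + 3(L − 1)`.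
[cite: Balaban1985UV3, (39) p.266, (41) p.266] -/
theorem collar_tower3 (D : TowerInput S G) (hM : 0 < D.M₁) (hRcol : ∀ i j, i ≤ j → j ≤ S.K → D.Rcol j ≤ D.Rcol i)
    (hL : 2 ≤ L) {ρ' r₀ : ℝ} (hρ : 0 ≤ ρ') (hr : 0 ≤ r₀)
    (hRle : ∀ i, i ≤ S.K → (D.Rcol i : ℝ) ≤ ρ' * xlog (S.gk i) ^ r₀)
    (hg : ∀ i, i ≤ S.K → 0 < S.gk i ∧ S.gk i ≤ 1) :
    ∀ k, k ≤ S.K → ∀ (h : Hist S.P k) (j : ℕ), j < k →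
      (ZVol D.M₁ D.Rcol k h j : ℝ) ≤
        ∑ e ∈ (Hist.disc h).filter (fun e => e.1 ≤ j),
          (2 * (2 * ρ' + 2 * ((L : ℝ) * (3 * ((D.M₁ : ℝ) - 1)) + 3 * ((L : ℝ) - 1)) + 20) * 1) ^ 3 *
            xlog (S.gk e.1) ^ (3 * r₀) := by
  intro k hk h j hjk
  classical
  have hjk' : j + 1 ≤ k := hjk
  have hkP : k ≤ S.P.m + S.P.K := by show k ≤ S.m + S.K; omega
  have hLP : 2 ≤ S.P.L := hL
  have hM1 : 1 ≤ D.M₁ := hM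
  have hL1 : 1 ≤ L := by omega
  have hMr : (1 : ℝ) ≤ D.M₁ := by exact_mod_cast hM1
  have hLr : (2 : ℝ) ≤ L := by exact_mod_cast hL
  -- the ℕ count, with `d = 3`, `P.L = L`
  have hN := zvol_le_sum D.M₁ D.Rcol hM hRcol hLP hkP hk h hjk'
  have hd : S.P.d = 3 := rfl
  have hPL : S.P.L = L := rfl
  rw [hd, hPL] at hN
  -- abbreviations
  set Br : ℝ := (L : ℝ) * (3 * ((D.M₁ : ℝ) - 1)) + 3 * ((L : ℝ) - 1) with hBr
  set Kc : ℝ := 2 * (2 * ρ' + 2 * Br + 20) * 1 with hKc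
  have hBr0 : 0 ≤ Br := by rw [hBr]; nlinarith
  have hKc0 : 0 ≤ Kc := by rw [hKc]; nlinarith
  have hx1 : ∀ i, i ≤ S.K → 1 ≤ xlog (S.gk i) := fun i hi => one_le_xlog (hg i hi).1 (hg i hi).2
  have hxr : ∀ i, i ≤ S.K → 1 ≤ xlog (S.gk i) ^ r₀ := fun i hi => Real.one_le_rpow (hx1 i hi) hr
  have hxr3 : ∀ i, i ≤ S.K → xlog (S.gk i) ^ (3 * r₀) = (xlog (S.gk i) ^ r₀) ^ (3 : ℕ) := by
    intro i hi
    have h3 : (3 : ℝ) * r₀ = r₀ * ((3 : ℕ) : ℝ) := by push_cast; ring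
    rw [h3, Real.rpow_mul_natCast (by linarith [hx1 i hi])]
  have hFnn : ∀ i, i ≤ S.K → 0 ≤ Kc ^ 3 * xlog (S.gk i) ^ (3 * r₀) := fun i hi =>
    mul_nonneg (pow_nonneg hKc0 3) (Real.rpow_nonneg (by linarith [hx1 i hi]) _)
  -- per-source comparison of the ball count with the target term
  have hterm : ∀ i : ℕ, i ≤ S.K →
      (((2 * ((2 * (D.Rcol i + (L * (3 * (D.M₁ - 1)) + 3 * (L - 1)) + 3) + 1 + (2 * 3 + 6)) + 1)) ^ 3 : ℕ) : ℝ) ≤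
        Kc ^ 3 * xlog (S.gk i) ^ (3 * r₀) := by
    intro i hi
    rw [Nat.cast_pow, hxr3 i hi, ← mul_pow]
    refine pow_le_pow_left₀ (Nat.cast_nonneg _) ?_ 3
    have hR := hRle i hi
    have hX := hxr i hi
    push_cast [Nat.cast_sub hM1, Nat.cast_sub hL1]
    rw [hKc, hBr]
    nlinarith [mul_nonneg hBr0 (sub_nonneg.mpr hX), mul_nonneg hρ (sub_nonneg.mpr hX)]
  -- the target sum dominates the source-indexed sum
  let T : Finset (ℕ × PlaqCode S.P) := (Finset.univ : Finset (Fin (j + 1))).biUnion fun i =>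
    (h (Fin.castLE hjk' i)).image fun p => ((i : ℕ), plaqCode p)
  have hTsub : T ⊆ (Hist.disc h).filter (fun e => e.1 ≤ j) := by
    intro e he
    simp only [T, Finset.mem_biUnion, Finset.mem_univ, true_and, Finset.mem_image] at he
    obtain ⟨i, p, hp, rfl⟩ := he
    rw [Finset.mem_filter, Hist.mem_disc]
    exact ⟨⟨Fin.castLE hjk' i, p, hp, rfl⟩, by simpa using Nat.lt_succ_iff.mp i.2⟩
  have hTsum : ∑ e ∈ T, Kc ^ 3 * xlog (S.gk e.1) ^ (3 * r₀) =
      ∑ i : Fin (j + 1), ((h (Fin.castLE hjk' i)).card : ℝ) * (Kc ^ 3 * xlog (S.gk i) ^ (3 * r₀)) := by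
    rw [Finset.sum_biUnion]
    · refine Finset.sum_congr rfl fun i _ => ?_
      rw [Finset.sum_image]
      · simp only [Finset.sum_const, nsmul_eq_mul]
      · intro p _ q _ hpq
        exact plaqCode_injective _ (Prod.ext_iff.mp hpq).2
    · intro i _ i' _ hii'
      simp only [Function.onFun]
      rw [Finset.disjoint_left]
      intro e he he'
      rw [Finset.mem_image] at he he'
      obtain ⟨p, _, rfl⟩ := he
      obtain ⟨q, _, hq⟩ := he'
      exact hii' (Fin.ext (by have := (Prod.ext_iff.mp hq).1; exact_mod_cast this.symm))
  calc (ZVol D.M₁ D.Rcol k h j : ℝ)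
      ≤ ((∑ i : Fin (j + 1), (h (Fin.castLE hjk' i)).card *
          (2 * ((2 * (D.Rcol i + (L * (3 * (D.M₁ - 1)) + 3 * (L - 1)) + 3) + 1 + (2 * 3 + 6)) + 1)) ^ 3 : ℕ) : ℝ) := by
        exact_mod_cast hN
    _ = ∑ i : Fin (j + 1), ((h (Fin.castLE hjk' i)).card : ℝ) *
          (((2 * ((2 * (D.Rcol i + (L * (3 * (D.M₁ - 1)) + 3 * (L - 1)) + 3) + 1 + (2 * 3 + 6)) + 1)) ^ 3 : ℕ) : ℝ) := by
        rw [Nat.cast_sum]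
        refine Finset.sum_congr rfl fun i _ => ?_
        rw [Nat.cast_mul]
    _ ≤ ∑ i : Fin (j + 1), ((h (Fin.castLE hjk' i)).card : ℝ) * (Kc ^ 3 * xlog (S.gk i) ^ (3 * r₀)) :=
        Finset.sum_le_sum fun i _ => mul_le_mul_of_nonneg_left (hterm i (by omega)) (Nat.cast_nonneg _)
    _ = ∑ e ∈ T, Kc ^ 3 * xlog (S.gk e.1) ^ (3 * r₀) := hTsum.symm
    _ ≤ ∑ e ∈ (Hist.disc h).filter (fun e => e.1 ≤ j), Kc ^ 3 * xlog (S.gk e.1) ^ (3 * r₀) :=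
        Finset.sum_le_sum_of_subset_of_nonneg hTsub fun e he _ =>
          hFnn e.1 (by have := (Finset.mem_filter.mp he).2; omega)

/-- **`LeafSystem.lf` FOR THE TOWER WITH THE COLLAR COUNT DISCHARGED:** `lf_tower3` with `hcollar` supplied by `collar_tower3`; the
remaining hypotheses are the small-factors leaf `hSF` ((67)–(71)), the booked Z-term rates, the properties of the collar widths
(`M₁ ≥ 1`, `Rcol` antitone and `Rcol i ≤ ρ′x(g_i)^{r₀}` on the window `i ≤ K`), `0 < g_i ≤ gs ≤ 1` on the window, and the provisos
NOT IN PRINT (with `c_gρ := K_c`).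
[cite: Balaban1985UV3, pp.273–274, (39) p.266] -/
theorem lf_tower3' (C : B10Assembly.Consts) (hd : C.d = 6 / Real.log C.L) (hCL : C.L = (L : ℝ)) (hL : 2 ≤ L)
    (D : TowerInput S G) {ρ' r₀ A c₁ gs ε : ℝ}
    (hsites : ∀ k, k ≤ S.K → S.sites k = (Fintype.card (Site S.P k) : ℝ))
    (hSF : SmallFactorsAll
      (histModel3 D (2 * (2 * ρ' + 2 * ((L : ℝ) * (3 * ((D.M₁ : ℝ) - 1)) + 3 * ((L : ℝ) - 1)) + 20)) 1 r₀ hsites) c₁ gs)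
    (hM : 0 < D.M₁) (hRcol : ∀ i j, i ≤ j → j ≤ S.K → D.Rcol j ≤ D.Rcol i) (hρ : 0 ≤ ρ') (hr : 0 ≤ r₀)
    (hRle : ∀ i, i ≤ S.K → (D.Rcol i : ℝ) ≤ ρ' * xlog (S.gk i) ^ r₀)
    (hz0 : ∀ j, j < S.K → 0 ≤ D.zcoef j) (hz : ∀ j, j < S.K → D.zcoef j ≤ A * xlog (S.gk j))
    (hA : 0 ≤ A) (hε : 0 < ε)
    (hrun : ∀ j, S.gk j = B10.gRun C.g C.L ε j)
    (hg : ∀ j, j ≤ S.K → 0 < S.gk j ∧ S.gk j ≤ gs) (hgs : gs ≤ 1)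
    (hp : r₀ * 3 + 2 ≤ 2 * D.p₀)
    (hb₁ : 8 * (A * (2 * (2 * ρ' + 2 * ((L : ℝ) * (3 * ((D.M₁ : ℝ) - 1)) + 3 * ((L : ℝ) - 1)) + 20) * 1) ^ 3 /
      (Real.log C.L / 2)) ≤ c₁ * D.b₀ ^ 2)
    (hb₂ : 56 ≤ c₁ * D.b₀ ^ 2) :
    ∀ k, k ≤ D.tower3.toTowerRun.K → ∀ U : D.tower3.toTowerRun.Cfg k,
      D.tower3.toTowerRun.LF k U (fun h => -(D.tower3.toTowerRun.mainT k h U) + D.tower3.toTowerRun.Zterm k h) ≤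
        Real.exp (C.d * D.tower3.toTowerRun.sites k) := by
  have hK : 0 ≤ 2 * (2 * ρ' + 2 * ((L : ℝ) * (3 * ((D.M₁ : ℝ) - 1)) + 3 * ((L : ℝ) - 1)) + 20) * 1 := by
    have : (1 : ℝ) ≤ D.M₁ := by exact_mod_cast hM
    have : (2 : ℝ) ≤ L := by exact_mod_cast hL
    nlinarith
  have hg1 : ∀ i, i ≤ S.K → 0 < S.gk i ∧ S.gk i ≤ 1 := fun i hi => ⟨(hg i hi).1, (hg i hi).2.trans hgs⟩
  refine lf_tower3 C hd hCL D hsites hSF ?_ hz0 hz hA hK hr hε hrun hg hgs hp hb₁ hb₂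
  intro k hk h j hjk
  exact collar_tower3 D hM hRcol hL hρ hr hRle hg1 k hk h j hjk

/-! ## §5 Admissible histories: domination with vanishing masses, and the leaf from admissibility-restricted small factors -/

/-- **DOMINATION, ADMISSIBLE FORM** (p1's `Carriers.lf_dominated` refined): if the masses VANISH off admissible histories
(`Carriers.Masses.stepWeight_of_not_admissible` for the lane's `histWeights3`; hypothesis `hW` about `D.W` here) and the exponent is
bounded on ADMISSIBLE histories by a function of the large-field set, then `LF k U F ≤ Σ_{Q ⊆ allCodes k} exp(B Q)`. [folklore] -/
theorem lf_dominated_adm (D : TowerInput S G)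
    (hW : ∀ (k : ℕ) (h : Hist S.P k) (U : GaugeField S.P k G), ¬ Hist.Admissible D.M₁ D.Rcol k h → D.W.mass k h U = 0)
    (k : ℕ) (U : GaugeField S.P k G) (F : Hist S.P k → ℝ) (B : Finset (ℕ × PlaqCode S.P) → ℝ)
    (hFB : ∀ h, Hist.Admissible D.M₁ D.Rcol k h → F h ≤ B h.disc) :
    LF D.W k U F ≤ ∑ Q ∈ (allCodes S.P k).powerset, Real.exp (B Q) := by
  classical
  calc LF D.W k U F
      ≤ ∑ h : Hist S.P k, Real.exp (B h.disc) := by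
        refine Finset.sum_le_sum fun h _ => ?_
        by_cases hadm : Hist.Admissible D.M₁ D.Rcol k h
        · calc D.W.mass k h U * Real.exp (F h)
              ≤ 1 * Real.exp (B h.disc) :=
                mul_le_mul (D.W.mass_le_one k h U) (Real.exp_le_exp.mpr (hFB h hadm)) (Real.exp_pos _).le zero_le_one
            _ = Real.exp (B h.disc) := one_mul _
        · rw [hW k h U hadm, zero_mul]
          exact (Real.exp_pos _).le
    _ = ∑ Q ∈ (Finset.univ : Finset (Hist S.P k)).image Hist.disc, Real.exp (B Q) := by
        rw [Finset.sum_image fun h _ h' _ hh => Hist.disc_injective k hh]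
    _ ≤ ∑ Q ∈ (allCodes S.P k).powerset, Real.exp (B Q) := by
        refine Finset.sum_le_sum_of_subset_of_nonneg ?_ (fun Q _ _ => (Real.exp_pos _).le)
        intro Q hQ
        obtain ⟨h, _, rfl⟩ := Finset.mem_image.1 hQ
        exact Finset.mem_powerset.2 h.disc_subset_allCodes

/-- **`LeafSystem.lf` FOR THE TOWER FROM ADMISSIBILITY-RESTRICTED SMALL FACTORS** — the form the lane closes: the small-factor
bound (67)–(71) is required only for ADMISSIBLE histories (`hSF`; there the regions `Δ′` of different scales are disjoint, p1's
`plaqCover_subset_Lam`), the masses vanish off admissible histories (`hW`), the collar count is PROVED (`collar_tower3`), the Z-term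
rates are booked (`hz0`/`hz`), and the provisos NOT IN PRINT are hypotheses (`c_gρ := K_c`).  Knit: `…LargeFieldKnitAdm.lf_leaf_of_leaves_adm`.
[cite: Balaban1985UV3, pp.273–274] -/
theorem lf_tower3_adm (C : B10Assembly.Consts) (hd : C.d = 6 / Real.log C.L) (hCL : C.L = (L : ℝ)) (hL : 2 ≤ L)
    (D : TowerInput S G) {ρ' r₀ A c₁ gs ε : ℝ}
    (hsites : ∀ k, k ≤ S.K → S.sites k = (Fintype.card (Site S.P k) : ℝ))
    (hW : ∀ (k : ℕ) (h : Hist S.P k) (U : GaugeField S.P k G), ¬ Hist.Admissible D.M₁ D.Rcol k h → D.W.mass k h U = 0)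
    (hSF : (∀ j, j ≤ S.K → 0 < S.gk j ∧ S.gk j ≤ gs) → ∀ k, k ≤ S.K → ∀ (U : GaugeField S.P k G) (h : Hist S.P k),
      Hist.Admissible D.M₁ D.Rcol k h →
        c₁ * ∑ e ∈ Hist.disc h, B10.pFun D.b₀ D.p₀ (S.gk e.1) ^ 2 / 4 ≤ D.tower3.mainT k h U)
    (hM : 0 < D.M₁) (hRcol : ∀ i j, i ≤ j → j ≤ S.K → D.Rcol j ≤ D.Rcol i) (hρ : 0 ≤ ρ') (hr : 0 ≤ r₀)
    (hRle : ∀ i, i ≤ S.K → (D.Rcol i : ℝ) ≤ ρ' * xlog (S.gk i) ^ r₀)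
    (hz0 : ∀ j, j < S.K → 0 ≤ D.zcoef j) (hz : ∀ j, j < S.K → D.zcoef j ≤ A * xlog (S.gk j))
    (hA : 0 ≤ A) (hε : 0 < ε)
    (hrun : ∀ j, S.gk j = B10.gRun C.g C.L ε j)
    (hg : ∀ j, j ≤ S.K → 0 < S.gk j ∧ S.gk j ≤ gs) (hgs : gs ≤ 1)
    (hp : r₀ * 3 + 2 ≤ 2 * D.p₀)
    (hb₁ : 8 * (A * (2 * (2 * ρ' + 2 * ((L : ℝ) * (3 * ((D.M₁ : ℝ) - 1)) + 3 * ((L : ℝ) - 1)) + 20) * 1) ^ 3 /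
      (Real.log C.L / 2)) ≤ c₁ * D.b₀ ^ 2)
    (hb₂ : 56 ≤ c₁ * D.b₀ ^ 2) :
    ∀ k, k ≤ D.tower3.toTowerRun.K → ∀ U : D.tower3.toTowerRun.Cfg k,
      D.tower3.toTowerRun.LF k U (fun h => -(D.tower3.toTowerRun.mainT k h U) + D.tower3.toTowerRun.Zterm k h) ≤
        Real.exp (C.d * D.tower3.toTowerRun.sites k) := by
  set Kc : ℝ := 2 * (2 * ρ' + 2 * ((L : ℝ) * (3 * ((D.M₁ : ℝ) - 1)) + 3 * ((L : ℝ) - 1)) + 20) with hKc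
  have hK : 0 ≤ Kc * 1 := by
    have : (1 : ℝ) ≤ D.M₁ := by exact_mod_cast hM
    have : (2 : ℝ) ≤ L := by exact_mod_cast hL
    rw [hKc]; nlinarith
  have hg1 : ∀ i, i ≤ S.K → 0 < S.gk i ∧ S.gk i ≤ 1 := fun i hi => ⟨(hg i hi).1, (hg i hi).2.trans hgs⟩
  let X := histModel3 D Kc 1 r₀ hsites
  have hA₀ : X.A₀ = 0 := rfl
  have hZ : ZtermRate X A := ztermRate3 D Kc 1 r₀ A hsites
    (fun k hk h j hjk => collar_tower3 D hM hRcol hL hρ hr hRle hg1 k hk h j hjk) hz0 hz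
  refine lf_leaf_of_leaves_adm C hd X (fun k h => Hist.Admissible D.M₁ D.Rcol k h) ?_ ?_ (fun k hk h _ => hZ k hk h)
    (zvolCover3 D Kc 1 r₀ hsites) hA hK hr hε hrun hg hgs ?_ hp ?_ hb₂
  · -- domination on admissible histories
    intro k hk U F B hFB
    have hk' : k ≤ S.K := hk
    have h1 : ∀ h : Hist S.P k, Hist.Admissible D.M₁ D.Rcol k h → F h ≤ B h.disc := fun h hadm => by
      have := hFB h hadm
      simp only [X, histModel3, if_pos hk'] at this
      exact this
    have h2 := lf_dominated_adm D hW k U F B h1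
    simp only [X, histModel3, zero_mul, add_zero, if_pos hk']
    exact h2
  · -- small factors on admissible histories
    intro hgg k hk U h hadm
    have hk' : k ≤ S.K := hk
    have := hSF hgg k hk' U h hadm
    simp only [X, histModel3, if_pos hk']
    exact this
  · show 3 * Real.log (L : ℝ) = 3 * Real.log C.L
    rw [hCL]
  · rw [hA₀, add_zero]
    exact hb₁

end Summit.QuantumFields.Balaban3D.Proofs.Run3LargeField

end
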